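import Summits.CriticalPhenomena.PercolationContinuityZ3.Theorems.SahiMasterFamilyStructZeroFlag
import Summits.CriticalPhenomena.PercolationContinuityZ3.Theorems.SahiMasterFamilyShrunkFrameZeros
import Summits.CriticalPhenomena.PercolationContinuityZ3.Theorems.SahiMasterFamilyFiveStep

/-!
# Structure theory of the zero-flag class, X: the zero set, and the master-conjecture step at every order

Unit `prim-master-conj` (crux anchor stmt-CriticalPhenomena-4575); STRUCTURE-THEORY.md §4.4–§4.5 (gen 6).
* **ZS** (`suppZeroFlag_of_sahiE_eq_zero`): structured core `W`, free increasing event, interior `p`, `E = 0` ⇒ the whole family is a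
  zero flag.  Proof: pick a non-pure member `v` (else the tree's frame zero set); the step inequality
  `E ≥ μ_p(N_v)·E(rest)` forces `E(rest) = 0`, so the rest is a zero flag (induction); peeling at `v` (`sahiE_peel`) then writes
  `0 = Σ_l E(rest with member l shrunk by U v)`, every term nonnegative by positivity on structured cores (the shrinks are structured:
  D = `structured_update_inter_head`), hence zero, hence (induction) a zero flag — which is the recursive certificate at slot `v`.
* **MAIN** (`masterFamily_step_all`): for increasing `U : Fin (n+3) → Set (Set ι)` with `(U ∘ m.succAbove) ∈ Z_{n+2}`:
  `E_{n+3} ≥ 0` for every `p ∈ [0,1]^ι`, and for interior `p`, `E_{n+3} = 0 ↔ U ∈ Z_{n+3}` — the step of the master conjecture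
  (MASTER-FAMILY.md) at every order, unconditionally; with the tree's `Z ⇒ E = 0` this closes the induction `EQ(k−1) ⇒ M(k) ∧ EQ(k)`.
Axioms standard. [this work]
-/

noncomputable section

open scoped Classical

namespace Summit.CriticalPhenomena.PercolationContinuityZ3.Theorems

open Finset Function MeasureTheory
open Literature.Combinatorics.Sahi2008
open Literature.Probability.LatticeModels (prodBernoulli)
open Literature.Probability.LatticeModels.Kahn2022 (Affects real_pos_of_nonempty)
open Literature.Probability.Percolation (DeterminedBy)
open Literature.Probability.Percolation.DecisionTree (ind ind_of_mem ind_of_not_mem ind_nonneg)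

variable {ι : Type} [Fintype ι] {κ : Type*} (U : κ → Set (Set ι))

/-! ### The step inequality, packaged -/

omit [Fintype ι] in
/-- Shrinking one member, seen through an injective enumeration, is an `update` of the indicator family. [this work] -/
theorem ind_comp_update_inter {c : ℕ} (V : Fin c → κ) (hV : Injective V) (l : Fin c) (B : Set (Set ι)) :
    (fun j => ind (update U (V l) (U (V l) ∩ B) (V j))) = update (fun j => ind (U (V j))) l (ind (U (V l)) * ind B) := by
  funext j
  by_cases hj : j = l
  · subst hj
    rw [update_self, update_self]
    funext ω; exact Literature.Probability.Percolation.BHK2006.ind_inter _ _ ω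
  · rw [update_of_ne (fun h => hj (hV h)), update_of_ne hj]

omit [Fintype ι] in
/-- Shrinking one member, seen through an injective enumeration, is an `update` of the event family. [this work] -/
theorem comp_update_inter {c : ℕ} (V : Fin c → κ) (hV : Injective V) (l : Fin c) (B : Set (Set ι)) :
    (fun j => update U (V l) (U (V l) ∩ B) (V j)) = update (fun j => U (V j)) l (U (V l) ∩ B) := by
  funext j
  by_cases hj : j = l
  · subst hj; rw [update_self, update_self]
  · rw [update_of_ne (fun h => hj (hV h)), update_of_ne hj]

/-- **The step inequality** (STRUCTURE-THEORY 4.1/4.4): for a structured core `W` with chain `v :: l₂` (`v` last), free index `d`, and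
an enumeration `V` of `insert d W` with `V i = v`:
`μ_p(N_v) · E(U ∘ V ∘ i.succAbove) ≤ E(U ∘ V)`, and `0 ≤ E(U ∘ V ∘ i.succAbove)`. [this work] -/
theorem sahiE_step_ineq (p : ι → unitInterval) (hU : ∀ k, IsUpperSet (U k)) (hne : ∀ k, (U k).Nonempty) {W : Finset κ} {d v : κ}
    (hd : d ∉ W) (hW : Structured U W) (hvW : v ∈ W) {l₂ : List κ} (hl₂W : l₂.toFinset = W.erase v) (hl₂ : GoodChain U l₂)
    (hl₂ne : l₂ ≠ []) {n : ℕ} (V : Fin (n + 2) → κ) (hV : Injective V) (himg : univ.image V = insert d W) {i : Fin (n + 2)}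
    (hi : V i = v) :
    0 ≤ sahiE (bernoulliWeight p) (n + 1) (fun j => ind (U (V (i.succAbove j)))) ∧
      (prodBernoulli p).real (cframe U W v \ U v) * sahiE (bernoulliWeight p) (n + 1) (fun j => ind (U (V (i.succAbove j)))) ≤
        sahiE (bernoulliWeight p) (n + 2) (fun j => ind (U (V j))) := by
  have hvl : GoodChain U (v :: l₂) := goodChain_cons_of_structured_erase U hU hne hW hvW hl₂W hl₂
  have hvl₂ : v ∉ l₂ := ((goodChain_cons U).1 hvl).2.1
  have hWv : Structured U (W.erase v) := ⟨l₂, hl₂W, hl₂⟩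
  have hA : hull (frameSupp U l₂) (U v) = cframe U W v := hull_frameSupp_erase U hU hne hW hvW hl₂W hl₂
  set A := cframe U W v with hAdef
  have hAu : IsUpperSet A := isUpperSet_cframe U hU W v
  have hvA : U v ⊆ A := subset_cframe U hU W v
  set Vm : Fin (n + 1) → κ := fun j => V (i.succAbove j) with hVmdef
  have hVm : Injective Vm := fun a b h => Fin.succAbove_right_injective (hV h)
  have himgm : univ.image Vm = insert d l₂.toFinset := by
    rw [hVmdef, image_succAbove_eq_erase V hV i, himg, hi, erase_insert_of_ne (fun h => by subst h; exact hd hvW), hl₂W]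
  have hdl : d ∉ insert v l₂.toFinset := by rw [hl₂W, insert_erase hvW]; exact hd
  have hl₂ne' : l₂.toFinset.Nonempty := by
    obtain ⟨x, hx⟩ := List.exists_mem_of_ne_nil l₂ hl₂ne; exact ⟨x, List.mem_toFinset.2 hx⟩
  have hrest : 0 ≤ sahiE (bernoulliWeight p) (n + 1) (fun j => ind (U (Vm j))) :=
    sahiE_nonneg_of_structured U p hU hne (d := d) (fun h => hdl (mem_insert_of_mem h)) ⟨l₂, rfl, hl₂⟩ hl₂ne' Vm hVm himgm
  refine ⟨hrest, ?_⟩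
  have emove : sahiE (bernoulliWeight p) (n + 2) (fun j => ind (U (V j))) =
      sahiE (bernoulliWeight p) (n + 2) (Fin.cons (ind (U v)) (fun j => ind (U (Vm j))) : Fin (n + 2) → Set ι → ℝ) := by
    rw [sahiE_eq_cons_succAbove _ n _ i, hi]
  have IH : ∀ R : Finset κ, R ⊆ l₂.toFinset → Structured U R → R.Nonempty → ∀ (c : ℕ) (V' : Fin c → κ), Injective V' →
      univ.image V' = insert d R → 0 ≤ sahiE (bernoulliWeight p) c (fun j => ind (U (V' j))) :=
    fun R hR hRs hRne c V' hV' himg' =>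
      sahiE_nonneg_of_structured U p hU hne (fun h => hdl (mem_insert_of_mem (hR h))) hRs hRne V' hV' himg'
  have hT2 := sahiE_cons_annihilator_le U p hU hne hvl hdl Vm hVm himgm IH
  rw [hA] at hT2
  -- Term 1 ≥ 0: `v` replaced by its frame
  set U₁ := update U v A with hU₁def
  have hU₁u : ∀ k, IsUpperSet (U₁ k) := by
    intro k; by_cases hk : k = v
    · subst hk; rw [hU₁def, update_self]; exact hAu
    · rw [hU₁def, update_of_ne hk]; exact hU k
  have hU₁ne : ∀ k, (U₁ k).Nonempty := by
    intro k; by_cases hk : k = v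
    · subst hk; rw [hU₁def, update_self]; exact (hne k).mono hvA
    · rw [hU₁def, update_of_ne hk]; exact hne k
  have hagree : ∀ w ∈ l₂, U w = U₁ w := fun w hw => by
    have hwv : w ≠ v := fun h => by subst h; exact hvl₂ hw
    rw [hU₁def, update_of_ne hwv]
  have hvl₁ : GoodChain U₁ (v :: l₂) := by
    rw [goodChain_cons]
    refine ⟨(goodChain_congr hagree).1 hl₂, hvl₂, ?_⟩
    rw [← frameSupp_congr hagree, hU₁def, update_self, ← hA, hull_hull, Set.union_self, sdiff_self]
    exact bot_le
  have hW₁ : Structured U₁ W := ⟨v :: l₂, by rw [List.toFinset_cons, hl₂W, insert_erase hvW], hvl₁⟩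
  have hT1 : 0 ≤ sahiE (bernoulliWeight p) (n + 2) (fun j => ind (U₁ (V j))) :=
    sahiE_nonneg_of_structured U₁ p hU₁u hU₁ne hd hW₁ ⟨v, hvW⟩ V hV himg
  have emove₁ : sahiE (bernoulliWeight p) (n + 2) (fun j => ind (U₁ (V j))) =
      sahiE (bernoulliWeight p) (n + 2) (Fin.cons (ind A) (fun j => ind (U (Vm j))) : Fin (n + 2) → Set ι → ℝ) := by
    rw [sahiE_eq_cons_succAbove _ n _ i, hi]
    congr 1
    funext j
    refine Fin.cases ?_ (fun j' => ?_) j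
    · simp [hU₁def]
    · simp only [Fin.cons_succ, hVmdef]
      rw [hU₁def, update_of_ne (fun h => Fin.succAbove_ne i j' (hV (h.trans hi.symm)))]
  rw [emove, sahiE_cons_ind_eq_sub _ _ hvA, ← emove₁]
  linarith

/-! ### The zero set -/

/-- **ZS (STRUCTURE-THEORY 4.4)**, inductive form. [this work] -/
theorem suppZeroFlag_of_sahiE_eq_zero_aux (p : ι → unitInterval) (hp : ∀ e, (p e : ℝ) ∈ Set.Ioo (0 : ℝ) 1) :
    ∀ (s : ℕ) (U : κ → Set (Set ι)), (∀ k, IsUpperSet (U k)) → (∀ k, (U k).Nonempty) → ∀ (W : Finset κ) (d : κ), d ∉ W →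
      Structured U W → W.Nonempty → W.card ≤ s → ∀ (c : ℕ) (V : Fin c → κ), Injective V → univ.image V = insert d W →
        sahiE (bernoulliWeight p) c (fun j => ind (U (V j))) = 0 → SuppZeroFlag c (fun j => U (V j))
  | 0, U, _, _, W, d, _, _, hWne, hWs, c, V, _, _, _ => by
    rw [Nat.le_zero, card_eq_zero] at hWs; exact absurd hWs hWne.ne_empty
  | s + 1, U, hU, hne, W, d, hd, hW, hWne, hWs, c, V, hV, himg, h0 => by
    have hc : c = W.card + 1 := by
      have := card_image_of_injective univ hV
      rw [card_univ, Fintype.card_fin, himg, card_insert_of_notMem hd] at this; exact this.symm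
    obtain ⟨n, rfl⟩ : ∃ n, c = n + 2 := ⟨c - 2, by have := hWne.card_pos; omega⟩
    have hmemV : ∀ x ∈ insert d W, ∃ j, V j = x := fun x hx => by
      have : x ∈ univ.image V := by rw [himg]; exact hx
      simpa [mem_image] using this
    by_cases hpure : nonpure U W = ∅
    · -- frame core: the tree's frame zero set
      obtain ⟨s₀, hs₀⟩ := hmemV d (mem_insert_self d W)
      refine (sahiE_ind_eq_zero_iff_of_frame p hp (fun j => U (V j)) (fun j => hU _) s₀ fun j j' hj hj' hjj' => ?_).1 h0
      have hjW : V j ∈ W := (mem_insert.1 (himg ▸ mem_image_of_mem V (mem_univ j))).resolve_left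
        (fun h => hj (hV (h.trans hs₀.symm)))
      have hj'W : V j' ∈ W := (mem_insert.1 (himg ▸ mem_image_of_mem V (mem_univ j'))).resolve_left
        (fun h => hj' (hV (h.trans hs₀.symm)))
      have pj : cframe U W (V j) = U (V j) := by
        refine Set.Subset.antisymm ?_ (subset_cframe U hU W _)
        by_contra h; exact (notMem_empty (V j)) (hpure ▸ ((mem_nonpure U).2 ⟨hjW, h⟩ : V j ∈ nonpure U W))
      have pj' : cframe U W (V j') = U (V j') := by
        refine Set.Subset.antisymm ?_ (subset_cframe U hU W _)
        by_contra h; exact (notMem_empty (V j')) (hpure ▸ ((mem_nonpure U).2 ⟨hj'W, h⟩ : V j' ∈ nonpure U W))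
      rw [← pj, ← pj']
      exact disjoint_esupp_cframe U hU hne hW hjW hj'W (fun h => hjj' (hV h))
    · -- a non-pure member `v`, last in a chain `v :: l₂`
      obtain ⟨v, hv⟩ := nonempty_of_ne_empty hpure
      rw [mem_nonpure] at hv
      obtain ⟨hvW, hvN⟩ := hv
      have hWv : Structured U (W.erase v) := structured_erase_of_not_subset U hU hne hW hvW hvN
      obtain ⟨l₂, hl₂W, hl₂⟩ := id hWv
      have hvl : GoodChain U (v :: l₂) := goodChain_cons_of_structured_erase U hU hne hW hvW hl₂W hl₂
      have hl₂ne : l₂ ≠ [] := by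
        intro h0'
        have hs0 : Safe U (W.erase v) = ∅ := safe_eq_empty_of_card_le_one U (by rw [← hl₂W, h0']; simp)
        have hNs := annihilator_subset_safe_erase U hU hne hW hvW hWv
        rw [hs0, Set.subset_empty_iff, Set.sdiff_eq_empty] at hNs
        exact hvN hNs
      have hl₂ne' : (W.erase v).Nonempty := by
        rw [← hl₂W]; obtain ⟨x, hx⟩ := List.exists_mem_of_ne_nil l₂ hl₂ne; exact ⟨x, List.mem_toFinset.2 hx⟩
      have hcard : (W.erase v).card ≤ s := by rw [card_erase_of_mem hvW]; omega
      have hdv : d ∉ W.erase v := fun h => hd (mem_of_mem_erase h)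
      obtain ⟨i, hi⟩ := hmemV v (mem_insert_of_mem hvW)
      set Vm : Fin (n + 1) → κ := fun j => V (i.succAbove j) with hVmdef
      have hVm : Injective Vm := fun a b h => Fin.succAbove_right_injective (hV h)
      have himgm : univ.image Vm = insert d (W.erase v) := by
        rw [hVmdef, image_succAbove_eq_erase V hV i, himg, hi, erase_insert_of_ne (fun h => by subst h; exact hd hvW)]
      -- STEP: the rest has `E = 0`, hence is a zero flag
      obtain ⟨hrest, hstep⟩ := sahiE_step_ineq U p hU hne hd hW hvW hl₂W hl₂ hl₂ne V hV himg hi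
      have hμN : 0 < (prodBernoulli p).real (cframe U W v \ U v) :=
        real_pos_of_nonempty p (fun e => hp e) (Set.nonempty_iff_ne_empty.2 fun h => hvN (Set.sdiff_eq_empty.1 h))
      have hrest0 : sahiE (bernoulliWeight p) (n + 1) (fun j => ind (U (Vm j))) = 0 := by
        rw [h0] at hstep
        have : (prodBernoulli p).real (cframe U W v \ U v) * sahiE (bernoulliWeight p) (n + 1) (fun j => ind (U (Vm j))) = 0 :=
          le_antisymm hstep (mul_nonneg hμN.le hrest)
        rcases mul_eq_zero.1 this with h | h
        · exact absurd h hμN.ne'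
        · exact h
      have hZm : SuppZeroFlag (n + 1) (fun j => U (Vm j)) :=
        suppZeroFlag_of_sahiE_eq_zero_aux p hp s U hU hne (W.erase v) d hdv hWv hl₂ne' hcard _ Vm hVm himgm hrest0
      -- the shrinks: each term of the peel at `v` is `E` of a structured-core family, hence ≥ 0
      have hshr : ∀ l : Fin (n + 1), Structured (update U (Vm l) (U (Vm l) ∩ U v)) (W.erase v) := by
        intro l
        have hl : Vm l ∈ insert d (W.erase v) := himgm ▸ mem_image_of_mem Vm (mem_univ l)
        rcases mem_insert.1 hl with hld | hlW
        · rw [hld]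
          refine (structured_congr fun w hw => ?_).1 hWv
          have hwd : w ≠ d := fun h => hdv (h ▸ hw)
          exact (update_of_ne hwd _ U).symm
        · rw [← hl₂W]
          exact (structured_update_inter_head U hU hne hvl (List.mem_toFinset.1 (by rw [hl₂W]; exact hlW))).1
      have hterm_nonneg : ∀ l : Fin (n + 1),
          0 ≤ sahiE (bernoulliWeight p) (n + 1) (fun j => ind (update U (Vm l) (U (Vm l) ∩ U v) (Vm j))) := by
        intro l
        set U' := update U (Vm l) (U (Vm l) ∩ U v) with hU'def
        have hU'u := isUpperSet_update_inter_family U hU (Vm l) (hU v)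
        have hU'ne := nonempty_update_inter_family U hU hne (Vm l) (hU v) (hne v)
        exact sahiE_nonneg_of_structured U' p hU'u hU'ne hdv (hshr l) hl₂ne' Vm hVm himgm
      -- peel at `i`
      have hpeel := sahiE_peel (bernoulliWeight p) n (fun j => ind (U (V j))) i
      rw [h0, hi] at hpeel
      have e0 : sahiE (bernoulliWeight p) (n + 1) (fun j => ind (U (V (i.succAbove j)))) = 0 := hrest0
      rw [e0, zero_mul, sub_zero] at hpeel
      have hsum : ∑ l : Fin (n + 1), sahiE (bernoulliWeight p) (n + 1)
          (fun j => ind (update U (Vm l) (U (Vm l) ∩ U v) (Vm j))) = 0 := by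
        rw [hpeel]
        refine sum_congr rfl fun l _ => ?_
        rw [ind_comp_update_inter U Vm hVm l (U v)]
      have hterm0 := (sum_eq_zero_iff_of_nonneg fun l _ => hterm_nonneg l).1 hsum
      -- assemble the certificate at slot `i`
      obtain ⟨k, rfl⟩ : ∃ k, n = k + 1 := ⟨n - 1, by
        have : 2 ≤ W.card := by
          have := card_erase_of_mem hvW; have := hl₂ne'.card_pos; omega
        omega⟩
      refine ⟨i, hZm, fun l => ?_⟩
      have hZl : SuppZeroFlag (k + 2) (fun j => update U (Vm l) (U (Vm l) ∩ U v) (Vm j)) := by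
        have hU'u := isUpperSet_update_inter_family U hU (Vm l) (hU v)
        have hU'ne := nonempty_update_inter_family U hU hne (Vm l) (hU v) (hne v)
        exact suppZeroFlag_of_sahiE_eq_zero_aux p hp s _ hU'u hU'ne (W.erase v) d hdv (hshr l) hl₂ne' hcard _ Vm hVm himgm
          (hterm0 l (mem_univ l))
      rw [comp_update_inter U Vm hVm l (U v)] at hZl
      simpa [hVmdef, hi] using hZl

/-- **ZS: the zero set on structured cores, every order** (STRUCTURE-THEORY 4.4): for interior `p`, a structured core plus a free
increasing event with `E = 0` is a zero flag. [this work] -/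
theorem suppZeroFlag_of_sahiE_eq_zero (p : ι → unitInterval) (hp : ∀ e, (p e : ℝ) ∈ Set.Ioo (0 : ℝ) 1) (hU : ∀ k, IsUpperSet (U k))
    (hne : ∀ k, (U k).Nonempty) {W : Finset κ} {d : κ} (hd : d ∉ W) (hW : Structured U W) (hWne : W.Nonempty) {c : ℕ}
    (V : Fin c → κ) (hV : Injective V) (himg : univ.image V = insert d W) (h0 : sahiE (bernoulliWeight p) c (fun j => ind (U (V j))) = 0) :
    SuppZeroFlag c (fun j => U (V j)) :=
  suppZeroFlag_of_sahiE_eq_zero_aux p hp W.card U hU hne W d hd hW hWne le_rfl c V hV himg h0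

/-! ### The master-conjecture step at every order -/

/-- **The step of the master conjecture, every order, unconditionally** (MASTER-FAMILY.md, STRUCTURE-THEORY Thm 2): for increasing
`U : Fin (n+3) → Set (Set ι)` whose sub-family off slot `m` lies in the zero-flag class `Z_{n+2}`:
`E_{n+3}(μ_p; 1_{U_0}, …) ≥ 0` for every `p ∈ [0,1]^ι`, and for `p` in the open cube `E_{n+3} = 0 ↔ U ∈ Z_{n+3}`. [this work] -/
theorem masterFamily_step_all (p : ι → unitInterval) {n : ℕ} (U : Fin (n + 3) → Set (Set ι)) (hU : ∀ j, IsUpperSet (U j))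
    (m : Fin (n + 3)) (hZ : SuppZeroFlag (n + 2) (fun j => U (m.succAbove j))) :
    0 ≤ sahiE (bernoulliWeight p) (n + 3) (fun j => ind (U j)) ∧
      ((∀ e, (p e : ℝ) ∈ Set.Ioo (0 : ℝ) 1) → (sahiE (bernoulliWeight p) (n + 3) (fun j => ind (U j)) = 0 ↔ SuppZeroFlag (n + 3) U)) := by
  by_cases hempty : ∃ j, U j = ∅
  · obtain ⟨j, hj⟩ := hempty
    have h0 := sahiE_ind_eq_zero_of_eq_empty p U j hj
    exact ⟨h0.ge, fun _ => ⟨fun _ => suppZeroFlag_of_mem_empty (n + 2) U j hj, fun _ => h0⟩⟩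
  · have hne : ∀ j, (U j).Nonempty := fun j => Set.nonempty_iff_ne_empty.2 fun h => hempty ⟨j, h⟩
    -- work with the classical decidability instance used by the structure theory
    letI : DecidableEq (Fin (n + 3)) := fun a b => Classical.propDecidable (a = b)
    set W : Finset (Fin (n + 3)) := univ.image m.succAbove with hWdef
    have hmW : m ∉ W := by
      rw [hWdef, mem_image]; rintro ⟨j, -, hj⟩; exact Fin.succAbove_ne m j hj
    have hW : Structured U W := structured_of_suppZeroFlag n U hU hne m.succAbove Fin.succAbove_right_injective hZ
    have hWne : W.Nonempty := ⟨m.succAbove 0, mem_image_of_mem _ (mem_univ 0)⟩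
    have himg : univ.image (id : Fin (n + 3) → Fin (n + 3)) = insert m W := by
      ext x
      simp only [image_id, mem_univ, mem_insert, hWdef, mem_image, true_and, true_iff]
      by_cases hx : x = m
      · exact Or.inl hx
      · obtain ⟨j, rfl⟩ := Fin.exists_succAbove_eq hx; exact Or.inr ⟨j, rfl⟩
    refine ⟨sahiE_nonneg_of_structured U p hU hne hmW hW hWne id injective_id himg, fun hp => ⟨fun h0 => ?_, fun hZ' => ?_⟩⟩
    · exact suppZeroFlag_of_sahiE_eq_zero U p hp hU hne hmW hW hWne id injective_id himg h0
    · exact sahiE_ind_eq_zero_of_suppZeroFlag p hZ'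

/-- **`masterFamily_step` without its hypotheses**: the statement of `SahiMasterFamilyHeredity.masterFamily_step` (there derived from
the conjectural `MasterFamilyNonneg (k+2)`, `MasterFamilyEqIff (k+2)`) holds unconditionally at every order. [this work] -/
theorem masterFamily_step_unconditional {k : ℕ} (p : ι → unitInterval) (hp : ∀ e, (p e : ℝ) ∈ Set.Ioo (0 : ℝ) 1)
    (U : Fin (k + 3) → Set (Set ι)) (hU : ∀ j, IsUpperSet (U j)) (m : Fin (k + 3))
    (hZ : SuppZeroFlag (k + 2) (fun j => U (m.succAbove j))) :
    0 ≤ sahiE (bernoulliWeight p) (k + 3) (fun j => ind (U j)) ∧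
      (sahiE (bernoulliWeight p) (k + 3) (fun j => ind (U j)) = 0 ↔ SuppZeroFlag (k + 3) U) :=
  ⟨(masterFamily_step_all p U hU m hZ).1, (masterFamily_step_all p U hU m hZ).2 hp⟩

/-- **Heredity closes the master conjecture, every order**: if an interior zero of `E_{k+3}` always has a vanishing
`E_{k+2}`-sub-family (`MasterFamilyHeredity (k+3)`) and the equality conjecture holds at order `k + 2`, then it holds at order
`k + 3` — with no positivity hypothesis. [this work] -/
theorem masterFamilyEqIff_succ_of_heredity {k : ℕ} (hH : MasterFamilyHeredity (k + 3)) (hE : MasterFamilyEqIff (k + 2)) :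
    MasterFamilyEqIff (k + 3) := by
  intro ι _ p hp U hU
  refine ⟨fun h0 => ?_, fun hZ => sahiE_ind_eq_zero_of_suppZeroFlag p hZ⟩
  obtain ⟨m, hm⟩ := hH ι p hp U hU h0
  have hZ : SuppZeroFlag (k + 2) (fun j => U (m.succAbove j)) := (hE ι p hp _ fun j => hU _).1 hm
  exact ((masterFamily_step_all p U hU m hZ).2 hp).1 h0

end Summit.CriticalPhenomena.PercolationContinuityZ3.Theorems
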